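import Summits.ABC.ABC.Theorems.CongruentialReceptacleTameLocalReceptacleStubFalseOfMatching

/-!
# Crux `TameLocalReceptacle` (stmt-ABC-14354) is FALSE modulo qualitative first-moment matching (MF)

Negative lemma of the RESHAPED line `SketchIdeator1` (lead `prover-line-stmt-ABC-14354-c1-0`, cycle 2), the
second branch of its checked skeleton `Cruxes/TameLocalReceptacle/Lines/SketchIdeator1.lean`:

* `stub_tlr_iff_itr` (Defs) — the crux ⇔ the single-table receptacle `IntegerTameReceptacle`;
* `stub_false_of_matching` — the five-family first-moment argument: matching of position-wise odd-prime
  data means (slack `δ·N`, every `δ > 0`) between three special families (a member `2^N·m`) and two generic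
  families kills every windowed single table with bounded sums (exact `2`-adic entries carry slope `6c₁ log 2`
  per unit of `N`; everything else telescopes).

Hence `MatchingHypothesis → ¬ TameLocalReceptacle` with `MatchingHypothesis := MatchingFamilies (1/4)` (landed
`--negative-modulo MatchingHypothesis`; the crux item stays open).  Compared with the cycle-1 negative lemma
`TameLocalReceptacle_false_of_PinningHypothesis` (EH: entry-wise pinning to an ABSOLUTE `O(1)`, i.e. relative
precision `O(1/log X)` in conditioned ternary-friable counts — the circle method's borderline), MF asks only
RELATIVE precision `o(1)` of the position-wise tame-data laws of `y`-smooth solutions of `a + b = c` under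
congruence conditions to moduli `q^{v+1} ≤ y^{O(1)}`, `y = X^η` — qualitative equidistribution, in print in
substance (de la Bretèche 1999; Lagarias–Soundararajan 2012; Drappeau 2015; Harper 2016; friable numbers in
progressions to `y^{4√e−δ}`: Soundararajan 2008, Harper 2012) but not in Mathlib, hence a hypothesis here.
Also recorded: the disjunction `PinningHypothesis ∨ MatchingHypothesis` refutes the crux.
-/

-- `Summit.<Summit>.<Problem>` is the mandated summit-side namespace (CONVENTIONS §2); for the
-- single-conjunct summit `ABC` the two coincide, so the duplicate `ABC.ABC` is deliberate.
set_option linter.dupNamespace false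

namespace Summit.ABC.ABC.Theorems.TameLocalReceptacle

open Literature.NumberTheory.DiophantineGeometry
open Summit.ABC.ABC.Theses.CongruentialReceptacle

/-- **MF, the hypothesis of the negative lemma** (`H` of `--negative-modulo`): the first-moment matching
hypothesis `MatchingFamilies` of the reshaped line at balance `κ = 1/4` — for some bound `V₀`, every
`δ > 0` and arbitrarily large `N` there are finite nonempty families `F_A, F_B, F_C` (the `a`-, `b`-,
`c`-member exactly divisible by `2^N`) and `G, G'` (`v₂(abc) ≤ V₀`) of `1/4`-balanced abc-triples whose
position-wise odd-prime data means of every window-bounded weight match within `δ·N` (special member's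
part against `G'`, the other two against `G`).  Intended witnesses: `y`-smooth box families at the scales
`X` and `X/2^N` (Defs docstring).  Research-level as a Lean theorem; NOT a published statement verbatim,
hence a hypothesis, not a Literature fact. -/
def MatchingHypothesis : Prop := MatchingFamilies (1 / 4)

/-- **The crux is false modulo MF** (negative lemma of the reshaped line `SketchIdeator1`): qualitative
first-moment matching at balance `1/4` refutes
`Summit.ABC.ABC.Theses.CongruentialReceptacle.TameLocalReceptacle` — transfer to the single table
(`stub_tlr_iff_itr`) and the five-family argument (`stub_false_of_matching`). [folklore] -/
theorem TameLocalReceptacle_false_of_MatchingHypothesis :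
    MatchingHypothesis → ¬ TameLocalReceptacle := fun hM h =>
  stub_false_of_matching (1 / 4) hM (by norm_num) (stub_tlr_iff_itr.mp h)

/-- **Either analytic input refutes the crux**: EH (`PinningHypothesis`, cycle 1) or MF
(`MatchingHypothesis`, cycle 2) — the composition of the reshaped checked skeleton with every stub but
the analytic disjunction landed. [folklore] -/
theorem TameLocalReceptacle_false_of_pinning_or_matching :
    PinningHypothesis ∨ MatchingHypothesis → ¬ TameLocalReceptacle := by
  rintro (hE | hM)
  · exact TameLocalReceptacle_false_of_PinningHypothesis hE
  · exact TameLocalReceptacle_false_of_MatchingHypothesis hM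

end Summit.ABC.ABC.Theorems.TameLocalReceptacle
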